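import Summits.QuantumFields.YangMills.Theorems.ParabolicTrajectoryContinuumLimitOnTrajectoryUclCore
import Summits.QuantumFields.YangMills.Theorems.ParabolicTrajectoryContinuumLimitOnTrajectoryUclTop
import Summits.QuantumFields.YangMills.Theorems.ParabolicTrajectoryContinuumLimitOnTrajectoryUclVar
import Summits.QuantumFields.YangMills.Theorems.ParabolicTrajectoryContinuumLimitOnTrajectoryUclMain
import Summits.QuantumFields.YangMills.Theorems.ParabolicTrajectoryContinuumLimitOnTrajectoryUclTails

/-!
# Crux `ContinuumLimitOnTrajectory` (stmt-QuantumFields-10522), line `two-orbit-synchronisation` (seat c2):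
# the registered stub `stub_uclOfGap : UCLOfGap` — the clustering leg

`UCL r sch` (the `k`-uniform spatial-clustering input E4 of the one-field OS packaging) from exact axis symmetry, polynomial volume growth,
the uniform-threshold plaquette-string bounds `UUVB` and a torus OS gap `TorusOSGap r sch Δ'` (crux (B)'s currency): the core clustering
estimate (`coreClustering_of`: main term by the polarised slab gap + the OS-variance bound `varBound_of_uuvb`, tails by sup norms / UUVB,
`main_term_bound`, `tail_terms_bound`) and the reduction `ucl_of_core` (rotation of the spatial direction into time, translation half of E1).
-/

set_option autoImplicit false

namespace Summit.QuantumFields.YangMills.Cruxes.ContinuumLimitOnTrajectory.TwoOrbitSynchronisation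

/-- **Stub `stub_uclOfGap` (line two-orbit-synchronisation, skeleton v3.1): uniform spatial clustering from a torus OS gap.** -/
theorem stub_uclOfGap : UCLOfGap :=
  fun _G _ _ _ _ _ _ r sch hAx hGr hU _Δ' hΔ' hgap =>
    ucl_of_core r sch hAx hGr hU
      (coreClustering_of r sch hΔ' hgap hU (varBound_of_uuvb r sch hU) hGr (main_term_bound r sch) (tail_terms_bound r sch))

end Summit.QuantumFields.YangMills.Cruxes.ContinuumLimitOnTrajectory.TwoOrbitSynchronisation
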